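import Literature.MathematicalPhysics.QuantumFieldTheory.Balaban1983to89.B9Eq3132TentPlaquettes
import Literature.MathematicalPhysics.QuantumFieldTheory.Balaban1983to89.B9Eq335CoverageWindow
import Literature.MathematicalPhysics.QuantumFieldTheory.Balaban1983to89.Node00.OpsYSectELetters

/-!
# `Balaban1983to89.B9Eq3132TentHull` — T. Bałaban, *Propagators for lattice gauge theories in a background field*, Commun. Math. Phys. **99** (1985) 389–434
# [Balaban1985BackgroundPropagators], p. 396 (the cube class of (3.35)) with [Balaban1984PropagatorsII] (2.1)–(2.3) p. 224: THE HULL OF AN INDEX BOND — the coordinate box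
# spanned by def-Y's transport origin (the centre of the source block) and the base block — LIES IN ONE CLASS CUBE OF INDEX `≥ j − 1` (case A: the big `j`-block of the
# base block; case B: a doubled big `(j−1)`-block around source ∪ target), and its sides are `≤ 2Lʲ < period∕2`

statement-level skeleton of published theorems with citation tags; proofs where landed; nothing here is a claim about the Yang–Mills mass gap

THE PRINT.  [B9] p. 396 (class cubes: unions of big blocks of `T_{Lʲη}`, `□ ⊂ Bʲ(Λ_j) ∪ B^{j+1}(Λ_{j+1})`, `□ ∩ Bʲ(Λ_j) ≠ ∅`); [4] p. 224 (2.1)–(2.3) (big blocks, the collar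
(2.2), `Λ_j`); (3.40) p. 397 (transport from the block representative).

WHY THIS FILE (dag-n06-i gen 14, N06 bundle F4, row 26).  The lasso bound `B9Eq340TaxiLasso` + the localisation `B9Eq340TaxiRungs` put every plaquette met by a base-block
lasso inside the coordinate box `hullBox y` = {sites whose `μ`-coordinate is within `side_μ` of the source block's corner}, `side_μ = Lʲ` except `2Lʲ` in the bond
direction when the base block is the TARGET block (case B: source block outside `Ω_j`).  THIS FILE proves the box facts the final assembly needs: the origin and the base
block lie in the box (`orgY_mem_hullBox`, `baseBlk_subset_hullBox`), `4Lʲ < period` (`four_mul_side_lt`), and ★★★ `exists_cubeClass396_hullBox`: a class cube of index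
`q.2 ≥ j − 1` containing the box — in case A n06-i's `exists_cubeClass396_baseBlk`; in case B the source block has level `j − 1` and the target block level `j`, and the
aligned cube of two big `(j−1)`-blocks cornered at the source block's big `(j−1)`-block is a class cube of index `j − 1` by n06-j's `levV1_window` (levels `{j−1, j}`).

WHAT IS PROVED (sorry-free; defs `cornerOf`, `hullSide`, `hullBox`).
* §1 torus blocks as aligned cubes: `val_cornerOf`, `iterBlock_eq_torusCube`, `cornerOf_shift_self ∕ _of_ne`, `embIter_mem_iterBlock'`.
* §2 `hullSide`, `hullBox`, `orgY_mem_hullBox`, `srcBlk_subset_hullBox`, `baseBlk_subset_hullBox`, `hullSide_le`, `four_mul_side_lt`, `two_mul_hullSide_le`.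
* §3 ★★★ `exists_cubeClass396_hullBox` (both cases).

HONEST SCOPE.  Lattice bookkeeping on def-Y's carriers and [4]'s domain axioms; nothing of [B9] asserted; count-neutral; N06 NOT discharged.  Cell `pub-ymgap` (HUMAN RULING
D-0062), Track A node N06 [B9], seat `pub-ymgap-dag-n06-i` (gen 14), 2026-08-27; a NEW file.
-/

noncomputable section

namespace Literature.MathematicalPhysics.QuantumFieldTheory.Balaban1983to89.B9Eq3132TentHull

open Node00
open B6KLevelCensusIndexV1 (KIdx kGeo)
open B6GlobalChartV1 (PV domT toBox)
open B6Ineq2142KLevelV1 (lvl base)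
open B5Eq118OneStroke (iterBlock mem_iterBlock mem_iterBlock_iff)
open B15DeterminingSets (embIter)
open B9BackgroundsKLevelV1 (cubeClass396 levV1 levV1_pos torusCube torusCube_mono mem_torusCube_iff_blk blk_toBox_eq_iff)
open B9Eq3132TentBumps (baseBlk orgY sideY)
open B9Eq3132TentPlaquettes (exists_cubeClass396_baseBlk levV1_eq_of_mem_baseBlk)
open B6MultiLevelBoxOperator (bigSide)

variable {d ℓ : ℕ} {hd : 1 ≤ d + 1} {hL : Odd (ℓ + 1) ∧ 1 < ℓ + 1} {b₀ b₁ : ℝ} (i : KIdx d ℓ hd hL b₀ b₁)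

/-! ## §1 Torus blocks as aligned torus cubes -/

/-- the lower corner of the fine block `Bʲ(b)`: coordinates `b_μ·Lʲ`. [cite: Balaban1984PropagatorsI, (1.6) p.18, dictionary] -/
def cornerOf (j : ℕ) (b : Site (PV d ℓ i.m i.K hd hL) j) : Site (PV d ℓ i.m i.K hd hL) 0 :=
  fun μ => (((b μ).val * (ℓ + 1) ^ j : ℕ) : ZMod ((PV d ℓ i.m i.K hd hL).sitesPerDir 0))

/-- the period is `Lʲ` times the number of `j`-blocks. [cite: Balaban1984PropagatorsI, (1.6) p.18, bookkeeping] -/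
theorem sitesPerDir_zero_eq {j : ℕ} (hj : j ≤ i.m + i.K) : (PV d ℓ i.m i.K hd hL).sitesPerDir 0 = (ℓ + 1) ^ j * (PV d ℓ i.m i.K hd hL).sitesPerDir j :=
  B6AgreeQaQV1Chart.sitesPerDir_zero_eq_mul (PV d ℓ i.m i.K hd hL) hj

/-- the corner's labels. [cite: Balaban1984PropagatorsI, (1.6) p.18, bookkeeping] -/
theorem val_cornerOf {j : ℕ} (hj : j ≤ i.m + i.K) (b : Site (PV d ℓ i.m i.K hd hL) j) (μ : Fin (d + 1)) : (cornerOf i j b μ).val = (b μ).val * (ℓ + 1) ^ j := by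
  unfold cornerOf
  rw [ZMod.val_natCast, Nat.mod_eq_of_lt]
  rw [sitesPerDir_zero_eq i hj, mul_comm]
  exact Nat.mul_lt_mul_of_pos_left (ZMod.val_lt _) (by positivity)

/-- ★ **A FINE BLOCK IS AN ALIGNED TORUS CUBE**: `Bʲ(b) = torusCube (cornerOf b) Lʲ`. [cite: Balaban1984PropagatorsI, (1.6) p.18; Balaban1985BackgroundPropagators, p.396] -/
theorem mem_iterBlock_iff_torusCube {j : ℕ} (hj : j ≤ i.m + i.K) (b : Site (PV d ℓ i.m i.K hd hL) j) (u : Site (PV d ℓ i.m i.K hd hL) 0) :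
    u ∈ iterBlock j b ↔ u ∈ torusCube (cornerOf i j b) ((ℓ + 1) ^ j) := by
  have hs : 0 < (ℓ + 1) ^ j := by positivity
  have hsN : (ℓ + 1) ^ j ∣ (PV d ℓ i.m i.K hd hL).sitesPerDir 0 := ⟨_, sitesPerDir_zero_eq i hj⟩
  have hc : ∀ μ, (ℓ + 1) ^ j ∣ (cornerOf i j b μ).val := fun μ => ⟨(b μ).val, by rw [val_cornerOf i hj, mul_comm]⟩
  rw [mem_torusCube_iff_blk i hs hsN _ hc, blk_toBox_eq_iff, mem_iterBlock_iff hj]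
  refine forall_congr' fun μ => ?_
  rw [val_cornerOf i hj, Nat.mul_div_cancel _ hs]

/-- the block representative (def-Y's transport origin) lies in its block. [cite: Balaban1985BackgroundPropagators, (3.40) p.397; Balaban1987RG1, (0.1) p.251] -/
theorem embIter_mem_iterBlock {j : ℕ} (hj : j ≤ i.m + i.K) (b : Site (PV d ℓ i.m i.K hd hL) j) : embIter j b ∈ iterBlock j b :=
  (mem_iterBlock _ _ _).2 (Node00.iterBlockOf_embIter j hj b)

/-- shifting the coarse site shifts the corner by `Lʲ` in that direction (as torus residues; wrap-around included). [cite: Balaban1984PropagatorsI, (1.7) p.18, bookkeeping] -/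
theorem cornerOf_shift_self {j : ℕ} (hj : j ≤ i.m + i.K) (b : Site (PV d ℓ i.m i.K hd hL) j) (m : Fin (d + 1)) :
    cornerOf i j (b.shift m) m = cornerOf i j b m + (((ℓ + 1) ^ j : ℕ) : ZMod ((PV d ℓ i.m i.K hd hL).sitesPerDir 0)) := by
  haveI : NeZero ((PV d ℓ i.m i.K hd hL).sitesPerDir j) := ⟨(PV d ℓ i.m i.K hd hL).sitesPerDir_ne_zero j⟩
  unfold cornerOf
  rw [← Nat.cast_add, ZMod.natCast_eq_natCast_iff', B6QGQTestBumpsKLevelV1.val_shift_self', sitesPerDir_zero_eq i hj,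
    show (b m).val * (ℓ + 1) ^ j + (ℓ + 1) ^ j = ((b m).val + 1) * (ℓ + 1) ^ j by ring, mul_comm ((ℓ + 1) ^ j) ((PV d ℓ i.m i.K hd hL).sitesPerDir j),
    Nat.mul_mod_mul_right, Nat.mul_mod_mul_right, Nat.mod_mod]

/-- … and leaves the other corner coordinates alone. [cite: Balaban1984PropagatorsI, (1.7) p.18, bookkeeping] -/
theorem cornerOf_shift_of_ne (j : ℕ) (b : Site (PV d ℓ i.m i.K hd hL) j) {m μ : Fin (d + 1)} (h : μ ≠ m) : cornerOf i j (b.shift m) μ = cornerOf i j b μ := by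
  unfold cornerOf; rw [B6Ineq2142KLevelV1.shift_apply_of_ne b h]

/-! ## §2 The hull box of an index bond -/

/-- case B of the base point: the source block lies OUTSIDE `Ω_j` (then the base block is the target block). [cite: Balaban1984PropagatorsII, (2.3) p.224] -/
def CaseB (y : IBondY i) : Prop := y.1.2.src ∉ (domT i.hN i.D i.hk).Om (lvl i.hN i.D i.hk y)

open Classical in
/-- the side of the hull box in direction `μ`: `2Lʲ` in the bond direction in case B, `Lʲ` otherwise (classical `if`). [cite: Balaban1985BackgroundPropagators, (3.40) p.397, bookkeeping ours] -/
def hullSide (y : IBondY i) (μ : Fin (d + 1)) : ℕ := if μ = y.1.2.dir ∧ CaseB i y then 2 * (ℓ + 1) ^ (lvl i.hN i.D i.hk y) else (ℓ + 1) ^ (lvl i.hN i.D i.hk y)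

/-- the hull box: sites within `hullSide_μ` of the source block's corner in every direction. [cite: Balaban1985BackgroundPropagators, (3.40) p.397, bookkeeping ours] -/
def hullBox (y : IBondY i) : Set (Site (PV d ℓ i.m i.K hd hL) 0) :=
  {u | ∀ μ, (u μ - cornerOf i (lvl i.hN i.D i.hk y) y.1.2.src μ).val < hullSide i y μ}

/-- `Lʲ ≤ hullSide ≤ 2Lʲ`. [cite: Balaban1985BackgroundPropagators, (3.40) p.397, bookkeeping] -/
theorem hullSide_le (y : IBondY i) (μ : Fin (d + 1)) : (ℓ + 1) ^ (lvl i.hN i.D i.hk y) ≤ hullSide i y μ ∧ hullSide i y μ ≤ 2 * (ℓ + 1) ^ (lvl i.hN i.D i.hk y) := by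
  unfold hullSide; split_ifs <;> constructor <;> omega

/-- the source block lies in the hull box. [cite: Balaban1985BackgroundPropagators, (3.40) p.397, bookkeeping] -/
theorem srcBlk_subset_hullBox (y : IBondY i) {u : Site (PV d ℓ i.m i.K hd hL) 0} (hu : u ∈ iterBlock (lvl i.hN i.D i.hk y) y.1.2.src) : u ∈ hullBox i y := by
  rw [mem_iterBlock_iff_torusCube i (B6Ineq2142KLevelV1.lvl_le_mK i.hN i.D i.hk y)] at hu
  exact fun μ => lt_of_lt_of_le (hu μ) (hullSide_le i y μ).1

/-- ★ def-Y's transport origin lies in the hull box. [cite: Balaban1985BackgroundPropagators, (3.40) p.397] -/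
theorem orgY_mem_hullBox (y : IBondY i) : orgY i y ∈ hullBox i y :=
  srcBlk_subset_hullBox i y (embIter_mem_iterBlock i (B6Ineq2142KLevelV1.lvl_le_mK i.hN i.D i.hk y) _)

/-- ★ the base block lies in the hull box (case A: it IS the source block; case B: the target block, one `Lʲ` further in the bond direction).
[cite: Balaban1984PropagatorsII, (2.3) p.224; Balaban1985BackgroundPropagators, (3.40) p.397] -/
theorem baseBlk_subset_hullBox (y : IBondY i) {u : Site (PV d ℓ i.m i.K hd hL) 0} (hu : u ∈ baseBlk i y) : u ∈ hullBox i y := by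
  have hj := B6Ineq2142KLevelV1.lvl_le_mK i.hN i.D i.hk y
  unfold baseBlk at hu
  by_cases hB : CaseB i y
  · -- case B: base = target = source shifted
    have hbase : base i.hN i.D i.hk y = y.1.2.tgt := B6QGQTestBumpsKLevelV1.base_eq_tgt_of i.hN i.D i.hk y hB
    rw [hbase] at hu
    have htgt : y.1.2.tgt = y.1.2.src.shift y.1.2.dir := rfl
    rw [htgt, mem_iterBlock_iff_torusCube i hj] at hu
    intro μ
    by_cases hμ : μ = y.1.2.dir
    · have h1 := hu μ
      rw [hμ] at h1 ⊢
      rw [cornerOf_shift_self i hj] at h1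
      unfold hullSide; rw [if_pos ⟨rfl, hB⟩]
      have e : u y.1.2.dir - cornerOf i (lvl i.hN i.D i.hk y) y.1.2.src y.1.2.dir =
          (u y.1.2.dir - (cornerOf i (lvl i.hN i.D i.hk y) y.1.2.src y.1.2.dir + (((ℓ + 1) ^ (lvl i.hN i.D i.hk y) : ℕ) : ZMod _))) +
            (((ℓ + 1) ^ (lvl i.hN i.D i.hk y) : ℕ) : ZMod _) := by ring
      rw [e]
      refine lt_of_le_of_lt (ZMod.val_add_le _ _) ?_
      have h2 : ((((ℓ + 1) ^ (lvl i.hN i.D i.hk y) : ℕ) : ZMod ((PV d ℓ i.m i.K hd hL).sitesPerDir 0))).val ≤ (ℓ + 1) ^ (lvl i.hN i.D i.hk y) := by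
        rw [ZMod.val_natCast]; exact Nat.mod_le _ _
      omega
    · have h1 := hu μ
      rw [cornerOf_shift_of_ne i _ _ hμ] at h1
      exact lt_of_lt_of_le h1 (hullSide_le i y μ).1
  · -- case A: base = source
    have hbase : base i.hN i.D i.hk y = y.1.2.src := B6QGQTestBumpsKLevelV1.base_eq_src_of i.hN i.D i.hk y (not_not.1 hB)
    rw [hbase] at hu
    exact srcBlk_subset_hullBox i y hu

/-- ★ `4Lʲ < period` (the torus has `Lᵏ·L·M_h·P′` sites per direction, `M_h ≥ 8`, `P′ ≥ 5`, `j ≤ k`). [cite: Balaban1984PropagatorsII, (2.1) p.224, bookkeeping] -/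
theorem four_mul_side_lt (y : IBondY i) : 4 * (ℓ + 1) ^ (lvl i.hN i.D i.hk y) < (PV d ℓ i.m i.K hd hL).sitesPerDir 0 := by
  rw [← i.hN 0]
  have hj : lvl i.hN i.D i.hk y ≤ i.k := B6Ineq2142KLevelV1.lvl_le i.hN i.D i.hk y
  have h8 : 8 ≤ i.Mh := i.hM8
  have h5 : 5 ≤ i.P' 0 := i.hP5 0
  have hpow : (ℓ + 1) ^ (lvl i.hN i.D i.hk y) ≤ (ℓ + 1) ^ i.k := Nat.pow_le_pow_right (by omega) hj
  show 4 * (ℓ + 1) ^ (lvl i.hN i.D i.hk y) < (ℓ + 1) ^ i.k * ((ℓ + 1) * (i.Mh * i.P' 0))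
  have h40 : 40 ≤ i.Mh * i.P' 0 := le_trans (by norm_num) (Nat.mul_le_mul h8 h5)
  have h1 : 1 ≤ ℓ + 1 := by omega
  have h40' : 40 ≤ (ℓ + 1) * (i.Mh * i.P' 0) := le_trans h40 (Nat.le_mul_of_pos_left _ (by omega))
  have hp : 1 ≤ (ℓ + 1) ^ (lvl i.hN i.D i.hk y) := Nat.one_le_pow _ _ (by omega)
  calc 4 * (ℓ + 1) ^ (lvl i.hN i.D i.hk y) < 40 * (ℓ + 1) ^ (lvl i.hN i.D i.hk y) := by omega
    _ ≤ 40 * (ℓ + 1) ^ i.k := Nat.mul_le_mul_left _ hpow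
    _ ≤ ((ℓ + 1) * (i.Mh * i.P' 0)) * (ℓ + 1) ^ i.k := Nat.mul_le_mul_right _ h40'
    _ = (ℓ + 1) ^ i.k * ((ℓ + 1) * (i.Mh * i.P' 0)) := by ring

/-- `2·hullSide ≤ period` (indeed `< period`). [cite: Balaban1984PropagatorsII, (2.1) p.224, bookkeeping] -/
theorem two_mul_hullSide_le (y : IBondY i) (μ : Fin (d + 1)) : 2 * hullSide i y μ ≤ (PV d ℓ i.m i.K hd hL).sitesPerDir 0 := by
  have h1 := (hullSide_le i y μ).2
  have h2 := four_mul_side_lt i y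
  omega

/-! ## §3 ★★★ The hull box lies in one class cube of index `≥ j − 1` -/

/-- in case A the hull box IS the source (= base) block. [cite: Balaban1984PropagatorsII, (2.3) p.224, bookkeeping] -/
theorem hullBox_subset_baseBlk_of_not_caseB (y : IBondY i) (hB : ¬ CaseB i y) {u : Site (PV d ℓ i.m i.K hd hL) 0} (hu : u ∈ hullBox i y) : u ∈ baseBlk i y := by
  have hj := B6Ineq2142KLevelV1.lvl_le_mK i.hN i.D i.hk y
  have hbase : base i.hN i.D i.hk y = y.1.2.src := B6QGQTestBumpsKLevelV1.base_eq_src_of i.hN i.D i.hk y (not_not.1 hB)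
  unfold baseBlk
  rw [hbase, mem_iterBlock_iff_torusCube i hj]
  intro μ
  have h := hu μ
  unfold hullSide at h
  rw [if_neg (fun h' => hB h'.2)] at h
  exact h

/-- `bigSide (j − 1) = M_h·Lʲ` for `j ≥ 1`. [cite: Balaban1984PropagatorsII, (2.1) p.224, bookkeeping] -/
theorem bigSide_pred {j : ℕ} (hj : 1 ≤ j) : bigSide ℓ i.Mh (j - 1) = i.Mh * (ℓ + 1) ^ j := by
  rw [B6MultiLevelBoxOperator.bigSide_eq]
  obtain ⟨j', rfl⟩ := Nat.exists_eq_add_of_le hj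
  rw [show 1 + j' - 1 = j' by omega, pow_add, pow_one]; ring

/-- in case B the level is `≥ 2` (`Ω₁` is everything). [cite: Balaban1984PropagatorsII, (2.1) p.224 («Ω_j = T_η for j = 1»), bookkeeping] -/
theorem two_le_lvl_of_caseB (y : IBondY i) (hB : CaseB i y) : 2 ≤ lvl i.hN i.D i.hk y := by
  have h1 := B6Ineq2142KLevelV1.one_le_lvl i.hN i.D i.hk (B9GeoLemma21KLevelV1.one_le_k i) y
  have hjk := B6Ineq2142KLevelV1.lvl_le i.hN i.D i.hk y
  by_contra hlt
  have hj : lvl i.hN i.D i.hk y = 1 := by omega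
  apply hB
  set u := embIter (lvl i.hN i.D i.hk y) y.1.2.src
  have hu : B5Eq118OneStroke.iterBlockOf (lvl i.hN i.D i.hk y) u = y.1.2.src := Node00.iterBlockOf_embIter _ (B6Ineq2142KLevelV1.lvl_le_mK i.hN i.D i.hk y) _
  have h := (B6GlobalChartV1.iterBlockOf_mem_domT_iff i.hN i.D i.hk h1 hjk u).2 (by rw [hj]; exact levV1_pos i u)
  rw [hu] at h
  exact h

/-- in case B the source block's sites have level `< j`. [cite: Balaban1984PropagatorsII, (2.3) p.224, bookkeeping] -/
theorem levV1_lt_of_caseB (y : IBondY i) (hB : CaseB i y) {u : Site (PV d ℓ i.m i.K hd hL) 0} (hu : u ∈ iterBlock (lvl i.hN i.D i.hk y) y.1.2.src) :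
    levV1 i u < lvl i.hN i.D i.hk y := by
  have hj1 := B6Ineq2142KLevelV1.one_le_lvl i.hN i.D i.hk (B9GeoLemma21KLevelV1.one_le_k i) y
  have hjk := B6Ineq2142KLevelV1.lvl_le i.hN i.D i.hk y
  have h := (B6GlobalChartV1.iterBlockOf_mem_domT_iff i.hN i.D i.hk hj1 hjk u).2
  rw [(mem_iterBlock _ _ _).1 hu] at h
  by_contra hge
  exact hB (h (not_lt.1 hge))

/-- ★★★ **THE HULL BOX LIES IN ONE CLASS CUBE OF INDEX `≥ j − 1`**: case A — the big `j`-block of the base block (index `j`); case B — the aligned cube of TWO big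
`(j−1)`-blocks cornered at the source block's big `(j−1)`-block (index `j − 1`: the source block has level `j − 1`, the target block level `j`, and by the collar (2.2) every
site of the cube has level in `{j−1, j}`). [cite: Balaban1985BackgroundPropagators, p.396 (the cube class); Balaban1984PropagatorsII, (2.1)–(2.3) p.224] -/
theorem exists_cubeClass396_hullBox (y : IBondY i) :
    ∃ q ∈ cubeClass396 i, lvl i.hN i.D i.hk y ≤ q.2 + 1 ∧ ∀ u ∈ hullBox i y, u ∈ q.1 := by
  by_cases hB : CaseB i y
  swap
  · obtain ⟨q, hq, hq2, hmem⟩ := exists_cubeClass396_baseBlk i y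
    exact ⟨q, hq, by omega, fun u hu => hmem u (hullBox_subset_baseBlk_of_not_caseB i y hB hu)⟩
  -- case B
  set j := lvl i.hN i.D i.hk y with hjdef
  have hj2 : 2 ≤ j := two_le_lvl_of_caseB i y hB
  have hjk : j ≤ i.k := B6Ineq2142KLevelV1.lvl_le i.hN i.D i.hk y
  have hjmK : j ≤ i.m + i.K := B6Ineq2142KLevelV1.lvl_le_mK i.hN i.D i.hk y
  have h8 : 8 ≤ i.Mh := i.hM8
  set sB := bigSide ℓ i.Mh (j - 1) with hsB
  have hsBeq : sB = i.Mh * (ℓ + 1) ^ j := bigSide_pred i (by omega)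
  have hsB0 : 0 < sB := by rw [hsBeq]; positivity
  -- the corner of the source block's big `(j−1)`-block
  let cQ : Site (PV d ℓ i.m i.K hd hL) 0 := fun μ => (((y.1.2.src μ).val / i.Mh * sB : ℕ) : ZMod _)
  have hNp : (PV d ℓ i.m i.K hd hL).sitesPerDir 0 = (ℓ + 1) ^ j * (PV d ℓ i.m i.K hd hL).sitesPerDir j := sitesPerDir_zero_eq i hjmK
  have hcQval : ∀ μ, (cQ μ).val = (y.1.2.src μ).val / i.Mh * sB := by
    intro μ
    show ((((y.1.2.src μ).val / i.Mh * sB : ℕ)) : ZMod ((PV d ℓ i.m i.K hd hL).sitesPerDir 0)).val = _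
    rw [ZMod.val_natCast, Nat.mod_eq_of_lt]
    rw [hNp, hsBeq]
    have hs := ZMod.val_lt (y.1.2.src μ)
    calc (y.1.2.src μ).val / i.Mh * (i.Mh * (ℓ + 1) ^ j) = ((y.1.2.src μ).val / i.Mh * i.Mh) * (ℓ + 1) ^ j := by ring
      _ ≤ (y.1.2.src μ).val * (ℓ + 1) ^ j := Nat.mul_le_mul_right _ (Nat.div_mul_le_self _ _)
      _ < (PV d ℓ i.m i.K hd hL).sitesPerDir j * (ℓ + 1) ^ j := Nat.mul_lt_mul_of_pos_right hs (by positivity)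
      _ = _ := by ring
  have hcQdvd : ∀ μ, sB ∣ (cQ μ).val := fun μ => ⟨(y.1.2.src μ).val / i.Mh, by rw [hcQval, mul_comm]⟩
  -- the hull box sits in the doubled cube
  have hsub : ∀ u ∈ hullBox i y, u ∈ torusCube cQ (2 * sB) := by
    intro u hu μ
    have h1 := hu μ
    have hside := (hullSide_le i y μ).2
    rw [← hjdef] at hside
    have h1' : (u μ - cornerOf i j y.1.2.src μ).val < hullSide i y μ := h1
    have hcB := val_cornerOf i hjmK y.1.2.src μ
    -- `(cB − cQ).val = (src % M_h)·Lʲ ≤ (M_h − 1)Lʲ`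
    have hdiff : (cornerOf i j y.1.2.src μ - cQ μ).val ≤ (i.Mh - 1) * (ℓ + 1) ^ j := by
      have hle : (cQ μ).val ≤ (cornerOf i j y.1.2.src μ).val := by
        rw [hcQval, hcB, hsBeq, ← mul_assoc]; exact Nat.mul_le_mul_right _ (Nat.div_mul_le_self _ _)
      rw [ZMod.val_sub hle, hcQval, hcB, hsBeq, ← mul_assoc, ← Nat.sub_mul]
      refine Nat.mul_le_mul_right _ ?_
      have h3 := Nat.div_add_mod' (y.1.2.src μ).val i.Mh
      have h4 := Nat.mod_lt (y.1.2.src μ).val (show 0 < i.Mh by omega)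
      omega
    have e : u μ - cQ μ = (u μ - cornerOf i j y.1.2.src μ) + (cornerOf i j y.1.2.src μ - cQ μ) := by ring
    rw [e]
    refine lt_of_le_of_lt (ZMod.val_add_le _ _) ?_
    have : (i.Mh - 1) * (ℓ + 1) ^ j + 2 * (ℓ + 1) ^ j ≤ 2 * sB := by
      rw [hsBeq]
      have : (i.Mh - 1) * (ℓ + 1) ^ j + 2 * (ℓ + 1) ^ j = (i.Mh + 1) * (ℓ + 1) ^ j := by
        rw [← Nat.add_mul]; congr 1; omega
      rw [this, ← mul_assoc]; exact Nat.mul_le_mul_right _ (by omega)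
    omega
  -- the two witnesses: the origin (level `j − 1`) and a base point (level `j`)
  set s₀ := orgY i y
  have hs₀S : s₀ ∈ iterBlock j y.1.2.src := embIter_mem_iterBlock i hjmK _
  have hs₀ : s₀ ∈ torusCube cQ (2 * sB) := hsub _ (orgY_mem_hullBox i y)
  set t₀ := B6Ineq2142KLevelV1.baseSite i.hN i.D i.hk y
  have ht₀B : t₀ ∈ baseBlk i y := (mem_iterBlock _ _ _).2 (B6Ineq2142KLevelV1.iterBlockOf_baseSite i.hN i.D i.hk y)
  have ht₀ : t₀ ∈ torusCube cQ (2 * sB) := hsub _ (baseBlk_subset_hullBox i y ht₀B)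
  have hlt₀ : levV1 i t₀ = j := levV1_eq_of_mem_baseBlk i y ht₀B
  have hls₀lt : levV1 i s₀ < j := levV1_lt_of_caseB i y hB hs₀S
  -- lower level bound on the cube from `t₀` (cube ⊆ its big `j`-block neighbourhood, `n = 1`)
  have hbig : torusCube cQ (2 * sB) ⊆ torusCube cQ (1 * bigSide ℓ i.Mh (levV1 i t₀)) := by
    refine torusCube_mono _ ?_
    rw [hlt₀, one_mul, show j = (j - 1) + 1 by omega, B6MultiLevelBoxOperator.bigSide_succ, ← hsB]
    have : 2 ≤ ℓ + 1 := by omega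
    exact Nat.mul_le_mul_right _ this
  have hR1 : 1 * (ℓ + 1) ≤ i.R := le_trans (by nlinarith [i.hℓ]) i.hR2
  have hlow : ∀ u ∈ torusCube cQ (2 * sB), j - 1 ≤ levV1 i u := by
    intro u hu
    have h := (B9Eq335CoverageWindow.levV1_window i hR1 (hbig ht₀) (hbig hu)).1
    rw [hlt₀] at h; omega
  have hls₀ : levV1 i s₀ = j - 1 := by have := hlow _ hs₀; omega
  have hup : ∀ u ∈ torusCube cQ (2 * sB), levV1 i u ≤ j := by
    intro u hu
    have hs₀' : s₀ ∈ torusCube cQ (2 * bigSide ℓ i.Mh (levV1 i s₀)) := by rw [hls₀]; exact hs₀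
    have hu' : u ∈ torusCube cQ (2 * bigSide ℓ i.Mh (levV1 i s₀)) := by rw [hls₀]; exact hu
    have h := (B9Eq335CoverageWindow.levV1_window_two i hs₀' hu').2
    rw [hls₀] at h; omega
  -- the period exceeds the doubled cube
  have hper : 2 * sB < (PV d ℓ i.m i.K hd hL).sitesPerDir 0 := by
    rw [← i.hN 0, hsBeq]
    have h5 : 5 ≤ i.P' 0 := i.hP5 0
    have hpow : (ℓ + 1) ^ j ≤ (ℓ + 1) ^ i.k := Nat.pow_le_pow_right (by omega) hjk
    show 2 * (i.Mh * (ℓ + 1) ^ j) < (ℓ + 1) ^ i.k * ((ℓ + 1) * (i.Mh * i.P' 0))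
    have hA : 2 * (i.Mh * (ℓ + 1) ^ j) ≤ 2 * (i.Mh * (ℓ + 1) ^ i.k) := Nat.mul_le_mul_left _ (Nat.mul_le_mul_left _ hpow)
    have hl : 5 ≤ ℓ + 1 := by have := i.hℓ; omega
    have hLP : 2 < (ℓ + 1) * i.P' 0 := lt_of_lt_of_le (by norm_num) (Nat.mul_le_mul hl h5)
    have hB : 2 * (i.Mh * (ℓ + 1) ^ i.k) < ((ℓ + 1) * i.P' 0) * (i.Mh * (ℓ + 1) ^ i.k) :=
      Nat.mul_lt_mul_of_pos_right hLP (by positivity)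
    calc 2 * (i.Mh * (ℓ + 1) ^ j) ≤ 2 * (i.Mh * (ℓ + 1) ^ i.k) := hA
      _ < ((ℓ + 1) * i.P' 0) * (i.Mh * (ℓ + 1) ^ i.k) := hB
      _ = (ℓ + 1) ^ i.k * ((ℓ + 1) * (i.Mh * i.P' 0)) := by ring
  refine ⟨(torusCube cQ (2 * sB), j - 1), ⟨by omega, by omega, ⟨cQ, 2, by norm_num, by norm_num, hcQdvd, hper, rfl⟩,
    fun u hu => ?_, ⟨s₀, hs₀, hls₀⟩⟩, by show j ≤ j - 1 + 1; omega, hsub⟩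
  have h1 := hlow u hu; have h2 := hup u hu
  show levV1 i u = j - 1 ∨ levV1 i u = j - 1 + 1
  omega

end Literature.MathematicalPhysics.QuantumFieldTheory.Balaban1983to89.B9Eq3132TentHull

end
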